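import Literature.Geometry.Lorentzian.TwoParameterFrame
import HarnessLib

/-!
# Covariant derivatives of smooth fields along two-parameter maps have smooth lifts

Infrastructure for the second variation of energy (layer 6b of the programme for
`Literature.Geometry.Riemannian.lee_expMap_injectivityDomain`, Lee 2018, Thm. 10.34 / Thm. 10.26).
For a locally `C^∞` covariant derivative `cov` on `TM`, a `C^∞` two-parameter map `x` and a field
`Z` on `x` with `C^∞` lift `(t, s) ↦ (x(t,s), Z(t,s)) ∈ TM`, the partial covariant derivative
`D_s Z` (the `covariantDerivAlong` of `Geodesic.lean` along the `s`-curves) again has a `C^∞`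
lift, jointly in `(t, s)` (`contMDiff_lift_covariantDerivAlong_curry_right`), and likewise
`D_t Z` (`contMDiff_lift_covariantDerivAlong_curry_left`). Proof: in the trivialisation at
`x(t₀, s₀)` the fibre coordinate of `D_s Z` is given by the chart formula
`A(D_s Z) = ∂_s Ẑ + ∑ᵢ Zⁱ Ĉᵢ(x)(∂_s x̂)` of `TwoParameterFrame.lean`
(`continuousLinearMapAt_covariantDerivAlong_curry_right`; O'Neill 1983, Ch. 4, p. 123), whose
right-hand side is a `C^∞` function of `(t, s)` (partial derivatives of smooth maps,
`ContDiffAt.fderiv`; smooth Christoffel data `exists_contMDiffOn_christoffel`).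

No definitions, no named facts (D-0026).

## References

* B. O'Neill, *Semi-Riemannian geometry* (1983), Ch. 3, Prop. 3.18; Ch. 4, pp. 122–123. [ONeill1983]
-/

noncomputable section

open Bundle Set Filter Function
open scoped Manifold ContDiff Topology

namespace Literature.Geometry.Riemannian

open Literature.Geometry.Lorentzian

variable {E : Type*} [NormedAddCommGroup E] [NormedSpace ℝ E] {H : Type*} [TopologicalSpace H]
  {I : ModelWithCorners ℝ E H} {M : Type*} [TopologicalSpace M] [ChartedSpace H M]
  [IsManifold I ∞ M]

/-- The fibre coordinate, in the trivialisation at `x₁`, of a field with `C^∞` lift along a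
two-parameter map is a `C^∞` map `ℝ × ℝ → E` at parameters mapped into the chart domain of `x₁`
(the `C^∞` case of `contDiffAt_trivializationAt_snd_uncurry`). [folklore] -/
theorem contDiffAt_trivializationAt_snd_uncurry_infty {x : ℝ → ℝ → M}
    {Z : (t : ℝ) → (s : ℝ) → TangentSpace I (x t s)} {x₁ : M} {t s : ℝ}
    (hsrc : x t s ∈ (chartAt H x₁).source)
    (hZ : ContMDiffAt (𝓘(ℝ, ℝ).prod 𝓘(ℝ, ℝ)) I.tangent ∞
      (fun q : ℝ × ℝ ↦ (TotalSpace.mk' E (x q.1 q.2) (Z q.1 q.2) : TangentBundle I M)) (t, s)) :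
    ContDiffAt ℝ ∞ (fun q : ℝ × ℝ ↦ (trivializationAt E (TangentSpace I : M → Type _) x₁
      (TotalSpace.mk' E (x q.1 q.2) (Z q.1 q.2) : TangentBundle I M)).2) (t, s) := by
  have he : (TotalSpace.mk' E (x t s) (Z t s) : TangentBundle I M) ∈
      (trivializationAt E (TangentSpace I : M → Type _) x₁).source := by
    rw [Trivialization.mem_source, TangentBundle.trivializationAt_baseSet]; exact hsrc
  have h1 : ContMDiffAt (𝓘(ℝ, ℝ).prod 𝓘(ℝ, ℝ)) 𝓘(ℝ, E) ∞ (fun q : ℝ × ℝ ↦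
      (trivializationAt E (TangentSpace I : M → Type _) x₁
        (TotalSpace.mk' E (x q.1 q.2) (Z q.1 q.2) : TangentBundle I M)).2) (t, s) :=
    (((trivializationAt E (TangentSpace I : M → Type _) x₁).contMDiffAt_iff
      (f := fun q : ℝ × ℝ ↦ (TotalSpace.mk' E (x q.1 q.2) (Z q.1 q.2) : TangentBundle I M)) he).1 hZ).2
  have h2 : ContMDiffAt 𝓘(ℝ, ℝ × ℝ) 𝓘(ℝ, E) ∞ (fun q : ℝ × ℝ ↦
      (trivializationAt E (TangentSpace I : M → Type _) x₁
        (TotalSpace.mk' E (x q.1 q.2) (Z q.1 q.2) : TangentBundle I M)).2) (t, s) := by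
    rw [modelWithCornersSelf_prod, ← chartedSpaceSelf_prod]; exact h1
  exact contMDiffAt_iff_contDiffAt.1 h2

variable [FiniteDimensional ℝ E]
  {cov : CovariantDerivative I E (TangentSpace I : M → Type _)}

/-- **`D_s Z` has a `C^∞` lift** for a `C^∞` field `Z` along a `C^∞` two-parameter map `x` and a
locally `C^∞` covariant derivative: `(t, s) ↦ (x(t, s), D_s Z(t, s)) ∈ TM` is `C^∞` (chart
formula `A(D_s Z) = ∂_s Ẑ + ∑ᵢ Zⁱ Ĉᵢ(x)(∂_s x̂)`, O'Neill 1983, Ch. 4, p. 123, whose right-hand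
side is smooth in `(t, s)`). [cite: ONeill1983, Ch. 4, p. 123] -/
theorem contMDiff_lift_covariantDerivAlong_curry_right (hcov : cov.IsLocallyContMDiff ∞)
    {x : ℝ → ℝ → M} {Z : (t : ℝ) → (s : ℝ) → TangentSpace I (x t s)}
    (hx : ContMDiff (𝓘(ℝ, ℝ).prod 𝓘(ℝ, ℝ)) I ∞ (uncurry x))
    (hZ : ContMDiff (𝓘(ℝ, ℝ).prod 𝓘(ℝ, ℝ)) I.tangent ∞
      (fun q : ℝ × ℝ ↦ (TotalSpace.mk' E (x q.1 q.2) (Z q.1 q.2) : TangentBundle I M))) :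
    ContMDiff (𝓘(ℝ, ℝ).prod 𝓘(ℝ, ℝ)) I.tangent ∞
      (fun q : ℝ × ℝ ↦ (TotalSpace.mk' E (x q.1 q.2)
        (covariantDerivAlong cov (x q.1) (Z q.1) q.2) : TangentBundle I M)) := by
  rintro ⟨t₀, s₀⟩
  set x₁ : M := x t₀ s₀ with hx₁
  set e₁ := trivializationAt E (TangentSpace I : M → Type _) x₁ with he₁
  set b := Module.finBasis ℝ E with hb
  obtain ⟨Ĉ, hĈ, hĈs⟩ := exists_contMDiffOn_christoffel (cov := cov) hcov b x₁
  have h2 : (2 : ℕ∞ω) ≤ ∞ := WithTop.coe_le_coe.2 le_top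
  -- parameters mapped into the chart domain
  have hsrc : ∀ᶠ q : ℝ × ℝ in 𝓝 (t₀, s₀), x q.1 q.2 ∈ (chartAt H x₁).source :=
    hx.continuous.continuousAt.preimage_mem_nhds
      ((chartAt H x₁).open_source.mem_nhds (mem_chart_source H x₁))
  have hmem : (TotalSpace.mk' E (x t₀ s₀) (covariantDerivAlong cov (x t₀) (Z t₀) s₀) :
      TangentBundle I M) ∈ e₁.source :=
    e₁.mem_source.2 (FiberBundle.mem_baseSet_trivializationAt' x₁)
  rw [e₁.contMDiffAt_iff
    (f := fun q : ℝ × ℝ ↦ (TotalSpace.mk' E (x q.1 q.2)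
      (covariantDerivAlong cov (x q.1) (Z q.1) q.2) : TangentBundle I M)) hmem]
  refine ⟨hx (t₀, s₀), ?_⟩
  -- the ingredients of the chart formula, as smooth functions of `q = (t, s)`
  set Zh : ℝ × ℝ → E := fun q ↦ (e₁ (TotalSpace.mk' E (x q.1 q.2) (Z q.1 q.2) :
    TangentBundle I M)).2 with hZh
  set xh : ℝ × ℝ → E := fun q ↦ extChartAt I x₁ (x q.1 q.2) with hxh
  have hZh_at : ∀ q : ℝ × ℝ, x q.1 q.2 ∈ (chartAt H x₁).source → ContDiffAt ℝ ∞ Zh q :=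
    fun q hq ↦ contDiffAt_trivializationAt_snd_uncurry_infty (x := x) (Z := Z) (t := q.1) (s := q.2)
      hq (hZ (q.1, q.2))
  have hxh_at : ∀ q : ℝ × ℝ, x q.1 q.2 ∈ (chartAt H x₁).source → ContDiffAt ℝ ∞ xh q :=
    fun q hq ↦ contDiffAt_extChartAt_uncurry' (x := x) (t := q.1) (s := q.2) hq (hx (q.1, q.2))
  -- the partial `s`-derivatives are smooth in `q`
  have hdZ : ContDiffAt ℝ ∞ (fun q : ℝ × ℝ ↦ fderiv ℝ (fun s' ↦ Zh (q.1, s')) q.2 (1 : ℝ)) (t₀, s₀) := by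
    have hF : ContDiffAt ℝ ∞ (uncurry fun (q : ℝ × ℝ) (s' : ℝ) ↦ Zh (q.1, s')) ((t₀, s₀), s₀) := by
      have hlin : ContDiff ℝ ∞ (fun z : (ℝ × ℝ) × ℝ ↦ ((z.1.1, z.2) : ℝ × ℝ)) :=
        (contDiff_fst.comp contDiff_fst).prodMk contDiff_snd
      exact (hZh_at (t₀, s₀) (mem_chart_source H x₁)).comp ((t₀, s₀), s₀) hlin.contDiffAt
    have h1 : ContDiffAt ℝ ∞ (fun q : ℝ × ℝ ↦ fderiv ℝ (fun s' ↦ Zh (q.1, s')) q.2) (t₀, s₀) :=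
      ContDiffAt.fderiv (f := fun (q : ℝ × ℝ) (s' : ℝ) ↦ Zh (q.1, s'))
        (g := fun q : ℝ × ℝ ↦ q.2) hF contDiffAt_snd (by simp)
    exact h1.clm_apply contDiffAt_const
  have hdx : ContDiffAt ℝ ∞ (fun q : ℝ × ℝ ↦ fderiv ℝ (fun s' ↦ xh (q.1, s')) q.2 (1 : ℝ)) (t₀, s₀) := by
    have hF : ContDiffAt ℝ ∞ (uncurry fun (q : ℝ × ℝ) (s' : ℝ) ↦ xh (q.1, s')) ((t₀, s₀), s₀) := by
      have hlin : ContDiff ℝ ∞ (fun z : (ℝ × ℝ) × ℝ ↦ ((z.1.1, z.2) : ℝ × ℝ)) :=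
        (contDiff_fst.comp contDiff_fst).prodMk contDiff_snd
      exact (hxh_at (t₀, s₀) (mem_chart_source H x₁)).comp ((t₀, s₀), s₀) hlin.contDiffAt
    have h1 : ContDiffAt ℝ ∞ (fun q : ℝ × ℝ ↦ fderiv ℝ (fun s' ↦ xh (q.1, s')) q.2) (t₀, s₀) :=
      ContDiffAt.fderiv (f := fun (q : ℝ × ℝ) (s' : ℝ) ↦ xh (q.1, s'))
        (g := fun q : ℝ × ℝ ↦ q.2) hF contDiffAt_snd (by simp)
    exact h1.clm_apply contDiffAt_const
  -- the Christoffel data along `x`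
  have hC : ∀ i, ContDiffAt ℝ ∞ (fun q : ℝ × ℝ ↦ Ĉ i (x q.1 q.2)) (t₀, s₀) := by
    intro i
    have h1 : ContMDiffAt (𝓘(ℝ, ℝ).prod 𝓘(ℝ, ℝ)) 𝓘(ℝ, E →L[ℝ] E) ∞
        (fun q : ℝ × ℝ ↦ Ĉ i (x q.1 q.2)) (t₀, s₀) :=
      ((hĈs i).contMDiffAt ((chartAt H x₁).open_source.mem_nhds (mem_chart_source H x₁))).comp
        (t₀, s₀) (hx (t₀, s₀))
    have h2' : ContMDiffAt 𝓘(ℝ, ℝ × ℝ) 𝓘(ℝ, E →L[ℝ] E) ∞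
        (fun q : ℝ × ℝ ↦ Ĉ i (x q.1 q.2)) (t₀, s₀) := by
      rw [modelWithCornersSelf_prod, ← chartedSpaceSelf_prod]; exact h1
    exact contMDiffAt_iff_contDiffAt.1 h2'
  -- the right-hand side of the chart formula is smooth
  have hR : ContDiffAt ℝ ∞ (fun q : ℝ × ℝ ↦
      fderiv ℝ (fun s' ↦ Zh (q.1, s')) q.2 (1 : ℝ) +
        ∑ i, b.coord i (Zh q) • Ĉ i (x q.1 q.2) (fderiv ℝ (fun s' ↦ xh (q.1, s')) q.2 (1 : ℝ)))
      (t₀, s₀) := by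
    refine hdZ.add (ContDiffAt.sum fun i _ ↦ ?_)
    have hc : ContDiffAt ℝ ∞ (fun q : ℝ × ℝ ↦ b.coord i (Zh q)) (t₀, s₀) :=
      ((b.coord i).toContinuousLinearMap).contDiff.contDiffAt.comp (t₀, s₀)
        (hZh_at (t₀, s₀) (mem_chart_source H x₁))
    exact hc.smul ((hC i).clm_apply hdx)
  -- it coincides with the fibre coordinate of `D_s Z` near `(t₀, s₀)`
  have heq : (fun q : ℝ × ℝ ↦ (e₁ (TotalSpace.mk' E (x q.1 q.2)
      (covariantDerivAlong cov (x q.1) (Z q.1) q.2) : TangentBundle I M)).2) =ᶠ[𝓝 (t₀, s₀)]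
      fun q : ℝ × ℝ ↦ fderiv ℝ (fun s' ↦ Zh (q.1, s')) q.2 (1 : ℝ) +
        ∑ i, b.coord i (Zh q) • Ĉ i (x q.1 q.2) (fderiv ℝ (fun s' ↦ xh (q.1, s')) q.2 (1 : ℝ)) := by
    filter_upwards [hsrc] with q hq
    have hbase : x q.1 q.2 ∈ e₁.baseSet := by
      rw [he₁, TangentBundle.trivializationAt_baseSet]; exact hq
    have hformula := continuousLinearMapAt_covariantDerivAlong_curry_right (cov := cov) (x := x)
      (Z := Z) (x₁ := x₁) (t := q.1) (s := q.2) b Ĉ hĈ hq ((hx (q.1, q.2)).of_le h2)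
      ((hZ (q.1, q.2)).of_le h2)
    rw [Trivialization.continuousLinearMapAt_apply_of_mem ℝ e₁ hbase] at hformula
    rw [hformula]
    rfl
  have hR' : ContMDiffAt (𝓘(ℝ, ℝ).prod 𝓘(ℝ, ℝ)) 𝓘(ℝ, E) ∞ (fun q : ℝ × ℝ ↦
      fderiv ℝ (fun s' ↦ Zh (q.1, s')) q.2 (1 : ℝ) +
        ∑ i, b.coord i (Zh q) • Ĉ i (x q.1 q.2) (fderiv ℝ (fun s' ↦ xh (q.1, s')) q.2 (1 : ℝ)))
      (t₀, s₀) := by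
    have h := contMDiffAt_iff_contDiffAt.2 hR
    rw [modelWithCornersSelf_prod, ← chartedSpaceSelf_prod] at h
    exact h
  exact hR'.congr_of_eventuallyEq heq

/-- **`D_t Z` has a `C^∞` lift** (the `t`-version of
`contMDiff_lift_covariantDerivAlong_curry_right`, by swapping the parameters).
[cite: ONeill1983, Ch. 4, p. 123] -/
theorem contMDiff_lift_covariantDerivAlong_curry_left (hcov : cov.IsLocallyContMDiff ∞)
    {x : ℝ → ℝ → M} {Z : (t : ℝ) → (s : ℝ) → TangentSpace I (x t s)}
    (hx : ContMDiff (𝓘(ℝ, ℝ).prod 𝓘(ℝ, ℝ)) I ∞ (uncurry x))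
    (hZ : ContMDiff (𝓘(ℝ, ℝ).prod 𝓘(ℝ, ℝ)) I.tangent ∞
      (fun q : ℝ × ℝ ↦ (TotalSpace.mk' E (x q.1 q.2) (Z q.1 q.2) : TangentBundle I M))) :
    ContMDiff (𝓘(ℝ, ℝ).prod 𝓘(ℝ, ℝ)) I.tangent ∞
      (fun q : ℝ × ℝ ↦ (TotalSpace.mk' E (x q.1 q.2)
        (covariantDerivAlong cov (fun t ↦ x t q.2) (fun t ↦ Z t q.2) q.1) : TangentBundle I M)) := by
  have hswap : ContMDiff (𝓘(ℝ, ℝ).prod 𝓘(ℝ, ℝ)) (𝓘(ℝ, ℝ).prod 𝓘(ℝ, ℝ)) ∞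
      (fun q : ℝ × ℝ ↦ ((q.2, q.1) : ℝ × ℝ)) := contMDiff_snd.prodMk contMDiff_fst
  have hx' : ContMDiff (𝓘(ℝ, ℝ).prod 𝓘(ℝ, ℝ)) I ∞ (uncurry fun s t ↦ x t s) := hx.comp hswap
  have hZ' : ContMDiff (𝓘(ℝ, ℝ).prod 𝓘(ℝ, ℝ)) I.tangent ∞
      (fun q : ℝ × ℝ ↦ (TotalSpace.mk' E (x q.2 q.1) (Z q.2 q.1) : TangentBundle I M)) :=
    hZ.comp hswap
  have h := contMDiff_lift_covariantDerivAlong_curry_right (cov := cov) hcov (x := fun s t ↦ x t s)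
    (Z := fun s t ↦ Z t s) hx' hZ'
  exact h.comp hswap

end Literature.Geometry.Riemannian
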